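import Summits.KontsevichZagierPeriods.KontsevichZagierPeriods.Theorems.SymplecticScissorsRealOnePeriodRelationsStubRealises
import Summits.KontsevichZagierPeriods.KontsevichZagierPeriods.Theorems.SymplecticScissorsRealOnePeriodRelationsStubRetractionAlgebra
import Literature.NumberTheory.Transcendental.CurvePeriodsTransportProofs
import Literature.NumberTheory.Transcendental.CurvePeriodsPathHomotopicProofs

/-!
# `RealOnePeriodRelations` (stmt-KontsevichZagierPeriods-10042), line `nash-retraction-thin-strip`:
# paths for the retraction `Θ` (helper file for the stub `stub_retraction`)

Geometric bookkeeping used when the retraction `Θ` consumes Huber–Wüstholz's elementary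
relations (R3) `exact`, (R4) `pushforward`, (R5) `boundary`:

* §1 the HOMOTOPY PREDICATE of the line — `∃ x y (p₀ p₁ : Path x y), γ₀ = p₀ ∧ γ₁ = p₁ on [0,1] ∧
  p₀.Homotopic p₁` in the subspace `Z(ℂ)` (the format of
  `CurvePeriods.span_single_sub_single_of_homotopic`): reflexivity for paths agreeing on `[0,1]`,
  symmetry, transitivity, images under polynomial maps of curves, and the passage from an explicit
  continuous homotopy on the square;
* §2 POLYNOMIAL IMAGES OF PATHS: `f ∘ γ` is a `CurvePath` on `Z′` (tree pattern of
  `CurvePeriods.exists_transport`), semialgebraic when `γ` is, and the realisations of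
  `b·(Z, f^*ω′, γ)` and `b·(Z′, ω′, f∘γ)` have the same integrand (the chain rule, as in
  `CurvePeriods.period_formPullback`) — (R4) costs nothing pointwise;
* §3 EXACT FORMS: a realisation of `b·(Z, dP, γ)` is congruent modulo `M₁` to the constant
  representation `Re(b(P(γ(1)) − P(γ(0))))` on `(0,1)`, GIVEN exactness in dimension one (the
  statement of the stub `stub_exactDimOne`, taken as a hypothesis) applied to
  `u = Re(b · P∘γ)`.

References: A. Huber, G. Wüstholz, *Transcendence and Linear Relations of 1-Periods* (2022),
§3.3.1, §13.1; M. Kontsevich, D. Zagier, *Periods* (2001), §1.2.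
-/

noncomputable section

open scoped BigOperators unitInterval
open Set MeasureTheory MvPolynomial
open Literature.NumberTheory.Transcendental Literature.NumberTheory.Transcendental.CurvePeriods
open Literature.ModelTheory.ExponentialFields (IsSemialgebraic)
open Summit.KontsevichZagierPeriods.SymplecticScissors.RealOnePeriodRelationsNegative (M₁ unitDom)

namespace Summit.KontsevichZagierPeriods.SymplecticScissors.RealOnePeriodRelations

namespace RetractionPaths

variable {Z Z' : CurveData}

/-! ## §1 The homotopy predicate -/

/-- Two `C¹` paths agreeing on `[0,1]` are homotopic in the sense of the line (take `p₀ = p₁`).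
[folklore] -/
theorem homotopic_of_eqOn (γ γ' : CurvePath Z) (h : ∀ t ∈ Icc (0 : ℝ) 1, γ.toFun t = γ'.toFun t) :
    ∃ (x y : Z.points) (p p' : Path x y), (∀ t : I, γ.toFun t = p t) ∧ (∀ t : I, γ'.toFun t = p' t) ∧
      p.Homotopic p' :=
  ⟨γ.src, γ.tgt, γ.toPath, γ.toPath, fun _ => rfl, fun t => (h t t.2).symm, Path.Homotopic.refl _⟩

/-- Symmetry of the homotopy predicate. [folklore] -/
theorem homotopic_symm {γ γ' : CurvePath Z}
    (h : ∃ (x y : Z.points) (p p' : Path x y), (∀ t : I, γ.toFun t = p t) ∧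
      (∀ t : I, γ'.toFun t = p' t) ∧ p.Homotopic p') :
    ∃ (x y : Z.points) (p p' : Path x y), (∀ t : I, γ'.toFun t = p t) ∧
      (∀ t : I, γ.toFun t = p' t) ∧ p.Homotopic p' := by
  obtain ⟨x, y, p, p', hp, hp', hh⟩ := h
  exact ⟨x, y, p', p, hp', hp, hh.symm⟩

/-- Two `Path`s agreeing pointwise with the same function on `[0,1]` are equal. [folklore] -/
theorem path_eq_of_eq {x y : Z.points} (p q : Path x y) (g : ℝ → (Fin Z.n → ℂ))
    (hp : ∀ t : I, g t = p t) (hq : ∀ t : I, g t = q t) : p = q :=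
  Path.ext (funext fun t => Subtype.ext ((hp t).symm.trans (hq t)))

/-- Transitivity of the homotopy predicate. [folklore] -/
theorem homotopic_trans {γ γ' γ'' : CurvePath Z}
    (h : ∃ (x y : Z.points) (p p' : Path x y), (∀ t : I, γ.toFun t = p t) ∧
      (∀ t : I, γ'.toFun t = p' t) ∧ p.Homotopic p')
    (h' : ∃ (x y : Z.points) (p p' : Path x y), (∀ t : I, γ'.toFun t = p t) ∧
      (∀ t : I, γ''.toFun t = p' t) ∧ p.Homotopic p') :
    ∃ (x y : Z.points) (p p' : Path x y), (∀ t : I, γ.toFun t = p t) ∧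
      (∀ t : I, γ''.toFun t = p' t) ∧ p.Homotopic p' := by
  obtain ⟨x, y, p, p', hp, hp', hh⟩ := h
  obtain ⟨x', y', q, q', hq, hq', hh'⟩ := h'
  have hx : x' = x := by
    apply Subtype.ext
    have h1 := hq 0
    have h2 := hp' 0
    rw [Set.Icc.coe_zero] at h1 h2
    rw [Path.source] at h1 h2
    exact h1.symm.trans h2
  have hy : y' = y := by
    apply Subtype.ext
    have h1 := hq 1
    have h2 := hp' 1
    rw [Set.Icc.coe_one] at h1 h2
    rw [Path.target] at h1 h2
    exact h1.symm.trans h2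
  subst hx hy
  have hpq : p' = q := path_eq_of_eq p' q γ'.toFun hp' hq
  subst hpq
  exact ⟨x', y', p, q', hp, hq', hh.trans hh'⟩

/-- The continuous map of point sets induced by a polynomial map of curves. [folklore] -/
theorem continuous_polyMap (f : Fin Z'.n → MvPolynomial (Fin Z.n) ℂ)
    (hfZ : ∀ z ∈ Z.points, (fun j => eval z (f j)) ∈ Z'.points) :
    Continuous (fun z : Z.points => (⟨fun j => eval (z : Fin Z.n → ℂ) (f j), hfZ z z.2⟩ : Z'.points)) :=
  (continuous_pi fun j => (MvPolynomial.continuous_eval (f j)).comp continuous_subtype_val).subtype_mk _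

/-- **Images of homotopic paths under a polynomial map of curves are homotopic.** If `γ ≃ γ′` on
`Z` and `δ`, `δ′` are `C¹` paths on `Z′` agreeing on `[0,1]` with `f ∘ γ`, `f ∘ γ′`, then `δ ≃ δ′`
(`Path.Homotopic.map`). [cite: HuberWustholz2022, §13.1 (B)] -/
theorem homotopic_map (f : Fin Z'.n → MvPolynomial (Fin Z.n) ℂ)
    (hfZ : ∀ z ∈ Z.points, (fun j => eval z (f j)) ∈ Z'.points) {γ γ' : CurvePath Z}
    (h : ∃ (x y : Z.points) (p p' : Path x y), (∀ t : I, γ.toFun t = p t) ∧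
      (∀ t : I, γ'.toFun t = p' t) ∧ p.Homotopic p')
    (δ δ' : CurvePath Z') (hδ : ∀ t ∈ Icc (0 : ℝ) 1, δ.toFun t = fun j => eval (γ.toFun t) (f j))
    (hδ' : ∀ t ∈ Icc (0 : ℝ) 1, δ'.toFun t = fun j => eval (γ'.toFun t) (f j)) :
    ∃ (x y : Z'.points) (p p' : Path x y), (∀ t : I, δ.toFun t = p t) ∧
      (∀ t : I, δ'.toFun t = p' t) ∧ p.Homotopic p' := by
  obtain ⟨x, y, p, p', hp, hp', hh⟩ := h
  let F : C(Z.points, Z'.points) :=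
    ⟨fun z => ⟨fun j => eval (z : Fin Z.n → ℂ) (f j), hfZ z z.2⟩, continuous_polyMap f hfZ⟩
  refine ⟨F x, F y, p.map F.continuous, p'.map F.continuous, fun t => ?_, fun t => ?_,
    hh.map F⟩
  · rw [hδ t t.2, Path.map_coe, Function.comp_apply, hp t]
    rfl
  · rw [hδ' t t.2, Path.map_coe, Function.comp_apply, hp' t]
    rfl

/-- **From an explicit continuous homotopy on the square to the homotopy predicate.** If
`H : ℝ² → Z(ℂ)` is continuous on `[0,1]²` with `H(s,0)`, `H(s,1)` independent of `s`, and the `C¹`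
paths `γ₀`, `γ₁` agree with `H(0,·)`, `H(1,·)` on `[0,1]`, then `γ₀ ≃ γ₁`.
[cite: HuberWustholz2022, §3.3.1] -/
theorem homotopic_of_continuousHomotopy (H : ℝ × ℝ → (Fin Z.n → ℂ))
    (hH : ContinuousOn H (Icc (0 : ℝ) 1 ×ˢ Icc (0 : ℝ) 1))
    (hHZ : ∀ x ∈ Icc (0 : ℝ) 1 ×ˢ Icc (0 : ℝ) 1, H x ∈ Z.points)
    (hH0 : ∀ s ∈ Icc (0 : ℝ) 1, H (s, 0) = H (0, 0))
    (hH1 : ∀ s ∈ Icc (0 : ℝ) 1, H (s, 1) = H (0, 1))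
    (γ₀ γ₁ : CurvePath Z) (hγ₀ : ∀ t ∈ Icc (0 : ℝ) 1, γ₀.toFun t = H (0, t))
    (hγ₁ : ∀ t ∈ Icc (0 : ℝ) 1, γ₁.toFun t = H (1, t)) :
    ∃ (x y : Z.points) (p p' : Path x y), (∀ t : I, γ₀.toFun t = p t) ∧
      (∀ t : I, γ₁.toFun t = p' t) ∧ p.Homotopic p' := by
  have hI0 : (0 : ℝ) ∈ Icc (0 : ℝ) 1 := ⟨le_rfl, zero_le_one⟩
  have hI1 : (1 : ℝ) ∈ Icc (0 : ℝ) 1 := ⟨zero_le_one, le_rfl⟩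
  -- end points
  have h00 : γ₁.toFun 0 = γ₀.toFun 0 := by rw [hγ₁ 0 hI0, hH0 1 hI1, ← hγ₀ 0 hI0]
  have h11 : γ₁.toFun 1 = γ₀.toFun 1 := by rw [hγ₁ 1 hI1, hH1 1 hI1, ← hγ₀ 1 hI1]
  -- `γ₁` as a path between the end points of `γ₀`
  let p' : Path γ₀.src γ₀.tgt := γ₁.toPath.cast (Subtype.ext h00.symm) (Subtype.ext h11.symm)
  have hp' : ∀ t : I, γ₁.toFun t = p' t := fun _ => rfl
  -- the homotopy as a continuous map on `I × I`
  have hmem : ∀ q : I × I, ((q.1 : ℝ), (q.2 : ℝ)) ∈ Icc (0 : ℝ) 1 ×ˢ Icc (0 : ℝ) 1 :=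
    fun q => ⟨q.1.2, q.2.2⟩
  have hcont : Continuous fun q : I × I => (⟨H ((q.1 : ℝ), (q.2 : ℝ)), hHZ _ (hmem q)⟩ : Z.points) :=
    (hH.comp_continuous (continuous_subtype_val.fst'.prodMk continuous_subtype_val.snd') hmem).subtype_mk _
  let G : Path.Homotopy γ₀.toPath p' :=
    { toFun := fun q => ⟨H ((q.1 : ℝ), (q.2 : ℝ)), hHZ _ (hmem q)⟩
      continuous_toFun := hcont
      map_zero_left := fun t => Subtype.ext (by
        show H (0, (t : ℝ)) = γ₀.toFun t
        rw [hγ₀ t t.2])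
      map_one_left := fun t => Subtype.ext (by
        show H (1, (t : ℝ)) = γ₁.toFun t
        rw [hγ₁ t t.2])
      prop' := fun s t ht => by
        rcases ht with ht | ht
        · subst ht
          show (⟨H ((s : ℝ), ((0 : I) : ℝ)), _⟩ : Z.points) = γ₀.toPath 0
          apply Subtype.ext
          show H ((s : ℝ), 0) = γ₀.toFun 0
          rw [hH0 s s.2, ← hγ₀ 0 hI0]
        · rw [Set.mem_singleton_iff] at ht
          subst ht
          apply Subtype.ext
          show H ((s : ℝ), 1) = γ₀.toFun 1
          rw [hH1 s s.2, ← hγ₀ 1 hI1] }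
  exact ⟨γ₀.src, γ₀.tgt, γ₀.toPath, p', fun _ => rfl, hp', ⟨G⟩⟩

/-! ## §2 Polynomial images of paths -/

/-- **The image `f ∘ γ` of a `C¹` path under a polynomial map of curves over `ℚ̄`** is a `C¹`
path on the target with algebraic end points. [cite: HuberWustholz2022, §13.1 (B)] -/
theorem exists_mapPath (f : Fin Z'.n → MvPolynomial (Fin Z.n) ℂ) (hf : ∀ j, HasAlgCoeffs (f j))
    (hfZ : ∀ z ∈ Z.points, (fun j => eval z (f j)) ∈ Z'.points) (γ : CurvePath Z) :
    ∃ δ : CurvePath Z', ∀ t, δ.toFun t = fun j => eval (γ.toFun t) (f j) :=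
  ⟨{ toFun := fun t j => eval (γ.toFun t) (f j)
     contDiffOn := contDiffOn_pi' fun j => contDiffOn_eval_comp γ.contDiffOn (f j)
     mem_points := fun t ht => hfZ _ (γ.mem_points t ht)
     algebraic_zero := fun j => (hf j).isAlgebraic_eval γ.algebraic_zero
     algebraic_one := fun j => (hf j).isAlgebraic_eval γ.algebraic_one }, fun _ => rfl⟩

/-- **Polynomial images of semialgebraic paths are semialgebraic** (real and imaginary parts of
`fⱼ(γ(t))` are `ℚ`-semialgebraic: `Realises.re_im_eval`). [cite: BochnakCosteRoy1998, §2.2] -/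
theorem isSAPath_map (f : Fin Z'.n → MvPolynomial (Fin Z.n) ℂ) (hf : ∀ j, HasAlgCoeffs (f j))
    (γ : CurvePath Z)
    (hγ : IsSemialgebraicMapOn ℚ {z : Fin 1 → ℝ | z 0 ∈ Set.Icc (0 : ℝ) 1}
      (fun z => Fin.append (fun i => (γ.toFun (z 0) i).re) (fun i => (γ.toFun (z 0) i).im)))
    (δ : CurvePath Z') (hδ : ∀ t, δ.toFun t = fun j => eval (γ.toFun t) (f j)) :
    IsSemialgebraicMapOn ℚ {z : Fin 1 → ℝ | z 0 ∈ Set.Icc (0 : ℝ) 1}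
      (fun z => Fin.append (fun i => (δ.toFun (z 0) i).re) (fun i => (δ.toFun (z 0) i).im)) := by
  have hdom := Realises.isSemialgebraic_IccDom
  have hc : ∀ j, IsSemialgebraicFunOn ℚ {z : Fin 1 → ℝ | z 0 ∈ Set.Icc (0 : ℝ) 1}
      (fun z => (eval (γ.toFun (z 0)) (f j)).re) ∧
      IsSemialgebraicFunOn ℚ {z : Fin 1 → ℝ | z 0 ∈ Set.Icc (0 : ℝ) 1}
      (fun z => (eval (γ.toFun (z 0)) (f j)).im) := fun j =>
    Realises.re_im_eval hdom (fun i => Realises.re_im_coord_of_path hγ i) (f j) (hf j)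
  refine IsSemialgebraicMapOn.of_forall hdom fun k => ?_
  refine Fin.addCases (fun j => ?_) (fun j => ?_) k
  · refine (hc j).1.congr fun z _ => ?_
    simp only [Fin.append_left, hδ]
  · refine (hc j).2.congr fun z _ => ?_
    simp only [Fin.append_right, hδ]

/-- **(R4) is pointwise**: a realisation of `b·(Z, f^*ω′, γ)` and a realisation of
`b·(Z′, ω′, δ)` with `δ = f ∘ γ` on `[0,1]` have the same integrand on `(0,1)` (the chain rule;
computation of `CurvePeriods.period_formPullback`), hence are congruent modulo `M₁`.
[cite: HuberWustholz2022, §13.1 (B) (p. 120)] -/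
theorem pullback_move (f : Fin Z'.n → MvPolynomial (Fin Z.n) ℂ)
    (ω' : Fin Z'.n → MvPolynomial (Fin Z'.n) ℂ) (b : ℂ) (γ : CurvePath Z) (δ : CurvePath Z')
    (hδ : ∀ t ∈ Icc (0 : ℝ) 1, δ.toFun t = fun j => eval (γ.toFun t) (f j))
    (r r' : KZ.IntegralRep 1)
    (hr : r.domain = {z | z 0 ∈ Set.Ioo (0 : ℝ) 1} ∧ ∀ z ∈ r.domain, r.integrand z =
      (b * ∑ i, MvPolynomial.eval (γ.toFun (z 0)) (formPullback f ω' i) *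
        deriv (fun u => γ.toFun u i) (z 0)).re)
    (hr' : r'.domain = {z | z 0 ∈ Set.Ioo (0 : ℝ) 1} ∧ ∀ z ∈ r'.domain, r'.integrand z =
      (b * ∑ j, MvPolynomial.eval (δ.toFun (z 0)) (ω' j) * deriv (fun u => δ.toFun u j) (z 0)).re) :
    KZ.of r - KZ.of r' ∈ M₁ := by
  refine RetractionAlgebra.sub_mem_of_eqOn r r' (hr.1.trans hr'.1.symm) fun x hx => ?_
  have ht : x 0 ∈ Set.Ioo (0 : ℝ) 1 := by
    have := hr.1 ▸ hx
    simpa using this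
  rw [hr.2 x hx, hr'.2 x (hr'.1 ▸ hr.1 ▸ hx)]
  congr 2
  -- the chain-rule identity at `t = x 0`
  set t := x 0 with ht_def
  have hderiv : ∀ j, deriv (fun u => δ.toFun u j) t =
      ∑ i, eval (γ.toFun t) (pderiv i (f j)) * deriv (fun u => γ.toFun u i) t := by
    intro j
    have hfj := hasDerivAt_eval_comp (fun i => γ.hasDerivAt ht i) (f j)
    have heq : (fun u => δ.toFun u j) =ᶠ[nhds t] fun u => eval (γ.toFun u) (f j) := by
      filter_upwards [Icc_mem_nhds ht.1 ht.2] with u hu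
      rw [hδ u hu]
    exact (hfj.congr_of_eventuallyEq heq).deriv
  have hpt : δ.toFun t = fun j => eval (γ.toFun t) (f j) := hδ t (Ioo_subset_Icc_self ht)
  simp_rw [hderiv, hpt, formPullback, map_sum, map_mul, eval_bind₁_eq, Finset.sum_mul,
    Finset.mul_sum]
  rw [Finset.sum_comm]
  refine Finset.sum_congr rfl fun i _ => Finset.sum_congr rfl fun j _ => ?_
  ring

/-! ## §3 Exact forms along semialgebraic paths -/

/-- **(R3) in dimension one.** Given exactness in dimension one (hypothesis: the statement of the
stub `stub_exactDimOne`), a realisation of `b·(Z, dP, γ)` along a `ℚ`-semialgebraic `C¹` path and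
the constant representation `Re(b·(P(γ(1)) − P(γ(0))))` on `(0,1)` are congruent modulo `M₁`:
apply exactness to `u(t) = Re(b · P(γ(t)))`, which is `ℚ`-semialgebraic and `C¹` on `[0,1]` with
`u′(t) = Re(b · Σᵢ ∂ᵢP(γ(t)) γᵢ′(t))`. [cite: HuberWustholz2022, §13.1 (A)] -/
theorem exact_move
    (hexact : ∀ (u : ℝ → ℝ), IsSemialgebraicFunOn ℚ {z : Fin 1 → ℝ | z 0 ∈ Set.Icc (0 : ℝ) 1}
        (fun z => u (z 0)) → ContDiffOn ℝ 1 u (Set.Icc (0 : ℝ) 1) →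
      ∀ (r r' : KZ.IntegralRep 1), r.domain = {z | z 0 ∈ Set.Ioo (0 : ℝ) 1} →
        r'.domain = {z | z 0 ∈ Set.Ioo (0 : ℝ) 1} →
        (∀ z ∈ r.domain, r.integrand z = deriv u (z 0)) → (∀ z ∈ r'.domain, r'.integrand z = u 1 - u 0) →
        KZ.of r - KZ.of r' ∈ M₁)
    (P : MvPolynomial (Fin Z.n) ℂ) (hP : HasAlgCoeffs P) (b : ℂ) (hb : IsAlgebraic ℚ b)
    (γ : CurvePath Z)
    (hγ : IsSemialgebraicMapOn ℚ {z : Fin 1 → ℝ | z 0 ∈ Set.Icc (0 : ℝ) 1}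
      (fun z => Fin.append (fun i => (γ.toFun (z 0) i).re) (fun i => (γ.toFun (z 0) i).im)))
    (r c : KZ.IntegralRep 1)
    (hr : r.domain = {z | z 0 ∈ Set.Ioo (0 : ℝ) 1} ∧ ∀ z ∈ r.domain, r.integrand z =
      (b * ∑ i, MvPolynomial.eval (γ.toFun (z 0)) (formD P i) * deriv (fun u => γ.toFun u i) (z 0)).re)
    (hc : c.domain = {z | z 0 ∈ Set.Ioo (0 : ℝ) 1} ∧ ∀ z ∈ c.domain, c.integrand z =
      (b * (MvPolynomial.eval (γ.toFun 1) P - MvPolynomial.eval (γ.toFun 0) P)).re) :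
    KZ.of r - KZ.of c ∈ M₁ := by
  -- the potential `u = Re(b · P∘γ)`
  set u : ℝ → ℝ := fun t => (b * eval (γ.toFun t) P).re with hu
  -- semialgebraicity on `[0,1]`
  have hdom := Realises.isSemialgebraic_IccDom
  have halg := isAlgebraic_re_im hb
  have husa : IsSemialgebraicFunOn ℚ {z : Fin 1 → ℝ | z 0 ∈ Set.Icc (0 : ℝ) 1} (fun z => u (z 0)) :=
    (re_im_mul (re_im_const hdom halg.1 halg.2)
      (Realises.re_im_eval hdom (fun i => Realises.re_im_coord_of_path hγ i) P hP)).1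
  -- `C¹` on `[0,1]`
  have hucd : ContDiffOn ℝ 1 u (Set.Icc (0 : ℝ) 1) :=
    Complex.reCLM.contDiff.comp_contDiffOn (contDiffOn_const.mul (contDiffOn_eval_comp γ.contDiffOn P))
  -- the derivative on `(0,1)`
  have hderiv : ∀ t ∈ Set.Ioo (0 : ℝ) 1, deriv u t =
      (b * ∑ i, eval (γ.toFun t) (formD P i) * deriv (fun u => γ.toFun u i) t).re := by
    intro t ht
    have h1 := hasDerivAt_eval_comp (fun i => γ.hasDerivAt ht i) P
    have h2 := (Complex.reCLM.hasFDerivAt).comp_hasDerivAt t (h1.const_mul b)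
    have h3 : HasDerivAt u (b * ∑ i, eval (γ.toFun t) (pderiv i P) * deriv (fun u => γ.toFun u i) t).re t := by
      simpa [hu, Function.comp_def] using h2
    rw [h3.deriv]
    rfl
  refine hexact u husa hucd r c hr.1 hc.1 (fun z hz => ?_) (fun z hz => ?_)
  · have hz' : z 0 ∈ Set.Ioo (0 : ℝ) 1 := by
      have := hr.1 ▸ hz
      simpa using this
    rw [hr.2 z hz, hderiv _ hz']
  · rw [hc.2 z hz, hu]
    simp only [mul_sub, Complex.sub_re]

end RetractionPaths

/-- HELPER ANCHOR of this file (registered on stmt-KontsevichZagierPeriods-10042): polynomial images of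
`C¹` paths are `C¹` paths. [cite: HuberWustholz2022, §13.1 (B)] -/
theorem helper_retractionPaths_mapPath : ∀ {Z Z' : CurveData} (f : Fin Z'.n → MvPolynomial (Fin Z.n) ℂ), (∀ j, HasAlgCoeffs (f j)) → (∀ z ∈ Z.points, (fun j => MvPolynomial.eval z (f j)) ∈ Z'.points) → ∀ γ : CurvePath Z, ∃ δ : CurvePath Z', ∀ t, δ.toFun t = fun j => MvPolynomial.eval (γ.toFun t) (f j) :=
  fun f hf hfZ γ => RetractionPaths.exists_mapPath f hf hfZ γ

end Summit.KontsevichZagierPeriods.SymplecticScissors.RealOnePeriodRelations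

end
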